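import Summits.Schanuel.Schanuel.Theorems.DiophantineDichotomyApproximationPropertyCycleAPIAt3DataThin
import Summits.Schanuel.Schanuel.Theorems.DiophantineDichotomyApproximationPropertyCycleAPIAt3SatelliteDichotomy
import HarnessLib

/-!
# Bézout for a rank-2 prime over a complete intersection of `ℚ[x₀, …, x₃]` (stub `ideg_le_mul_of_rankTwo`)

Crux `stmt-Schanuel-6117` (`Summit.Schanuel.Schanuel.Theses.DiophantineDichotomy.ApproximationProperty`),
line `orbit-interpolation-determinant`, skeleton v24, registered support stub
`ideg_le_mul_of_rankTwo`: if `(Q)` is prime, `Q ≠ 0` a form of degree `a ≥ 1`, `P ∉ (Q)` a form of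
degree `b ≥ 1`, then every prime `𝔮'` of `ℚ[x₀, …, x₃]` which is unmixed of rank `2`
(`dim ℚ[x̲]/𝔮' = 2`, a `ℚ`-curve) and contains `Q` and `P` has `deg 𝔮' ≤ ab`.

Proof (two steps, all ingredients landed).
1. `𝔮'` is a MINIMAL prime of `(Q, P)`: a minimal prime `𝔮₀ ≤ 𝔮'` of `(Q, P)` exists
   (`Ideal.exists_minimalPrimes_le`) and has `dim ℚ[x̲]/𝔮₀ = 2` (`minimalPrimes_cut_facts`, Krull's
   principal ideal theorem for the cut of the rank-`3` prime `(Q)` by `P`), while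
   `dim ℚ[x̲]/𝔮' = 2`; a strict inclusion `𝔮₀ < 𝔮'` would give `2 + 1 ≤ 2`
   (`SatelliteDichotomy.ringKrullDim_quotient_add_one_le_of_lt`), exactly as in the landed
   `FourthForm.minimal_or_satellite`.
2. The `u`-resultant computation of the landed `CycleAP3DataThinProof.card_minimalPrimes_le`: over
   the finite set `𝓠` of minimal primes of `(Q, P)` the `u`-resultant of `P` over the generic plane
   section of `V(Q)` is `c ∏_𝔮 F_𝔮^{e_𝔮}` with `e_𝔮 ≥ 1` (`exists_uResultant_eq_C_mul_prod_pow`),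
   the unmixed ideal `J` of the cycle has `deg J = Σ e_𝔮 deg 𝔮` (`exists_cycle_ideal`, Prop. 4.7 1))
   and `deg J = deg_{u₁}(u-resultant) = deg (Q) · b = ab` (`invariants_of_chowForm_eq_C_mul`,
   `blockDeg_uResultant`, `ideg_span_singleton`; Prop. 4.8 1), 4.11); hence
   `deg 𝔮' ≤ e_{𝔮'} deg 𝔮' ≤ Σ e_𝔮 deg 𝔮 = ab`.

Proofs only (no definitions, no named facts). Sources: Nesterenko–Philippon (eds.), LNM 1752 (2001),
Ch. 3 §4 (Prop. 4.4, 4.7, 4.8, 4.11); Ch. 10 §3 (Macaulay unmixedness of the c.i. curve).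
-/

set_option linter.dupNamespace false

noncomputable section

attribute [local instance] MvPolynomial.gradedAlgebra

namespace Summit.Schanuel.Schanuel.Cruxes.ApproximationProperty.OrbitInterpolationDeterminant

open Literature.NumberTheory.Transcendental Literature.NumberTheory.Transcendental.Nesterenko MvPolynomial
open Literature.NumberTheory.Transcendental.PhilipponMain (ringKrullDim_quotient_eq_of_isUnmixedOfRank
  isUnmixedOfRank_span_singleton)
open scoped BigOperators

namespace IdegLeMulOfRankTwoProof

variable {Q P : Rx 3} {a b : ℕ}

/-- **A rank-2 prime over the c.i. curve `(Q, P)` is one of its minimal primes**: if `(Q)` is prime,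
`Q ≠ 0` a form of degree `a ≥ 1`, `P ∉ (Q)` a form of degree `b ≥ 1`, and `𝔮' ⊇ (Q, P)` is a prime
with `dim ℚ[x̲]/𝔮' = 2`, then `𝔮'` is a minimal prime of `(Q, P)` (a minimal prime `𝔮₀ ≤ 𝔮'` of
the cut has `dim = 2` by Krull's principal ideal theorem, and strict inclusions of primes lengthen
chains). [cite: NesterenkoPhilippon2001, Ch. 3 Prop. 4.11 (pp. 40–41); Ch. 10 §3 (proof of Prop. 3.6)] -/
theorem mem_minimalPrimes (hQ0 : Q ≠ 0) (hQhom : Q.IsHomogeneous a) (hPhom : P.IsHomogeneous b)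
    (hQprime : (Ideal.span {Q}).IsPrime) (hPQ : P ∉ Ideal.span {Q}) {𝔮' : Ideal (Rx 3)}
    (h𝔮'prime : 𝔮'.IsPrime) (h𝔮'unm : IsUnmixedOfRank 𝔮' 2) (hQ𝔮' : Q ∈ 𝔮') (hP𝔮' : P ∈ 𝔮') :
    𝔮' ∈ (Ideal.span {Q} ⊔ Ideal.span {P}).minimalPrimes := by
  have hle : Ideal.span {Q} ⊔ Ideal.span {P} ≤ 𝔮' :=
    sup_le ((Ideal.span_singleton_le_iff_mem _).mpr hQ𝔮') ((Ideal.span_singleton_le_iff_mem _).mpr hP𝔮')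
  obtain ⟨𝔮₀, h𝔮₀min, h𝔮₀le⟩ := Ideal.exists_minimalPrimes_le hle
  have h𝔭hom : (Ideal.span {Q}).IsHomogeneous (homogeneousSubmodule (Fin (3 + 1)) ℚ) :=
    SpaceCI.isHomogeneous_span hQhom
  have h𝔭unm : IsUnmixedOfRank (Ideal.span {Q}) 3 :=
    isUnmixedOfRank_span_singleton hQ0 fun h => hQprime.ne_top (Ideal.span_singleton_eq_top.mpr h)
  obtain ⟨h𝔮₀prime, -, hdim₀, -, -⟩ :=
    minimalPrimes_cut_facts (r := 2 + 1) (by norm_num) hQprime h𝔭hom h𝔭unm hPhom hPQ h𝔮₀min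
  rw [Nat.add_sub_cancel] at hdim₀
  have hdim' : ringKrullDim (Rx 3 ⧸ 𝔮') = (2 : ℕ) :=
    ringKrullDim_quotient_eq_of_isUnmixedOfRank h𝔮'prime h𝔮'unm
  -- `𝔮₀ = 𝔮'`, since a strict inclusion would give `2 + 1 ≤ 2`
  have heq : 𝔮₀ = 𝔮' := by
    by_contra hne
    haveI := h𝔮₀prime
    have hlt : 𝔮₀ < 𝔮' := lt_of_le_of_ne h𝔮₀le hne
    have h := SatelliteDichotomy.ringKrullDim_quotient_add_one_le_of_lt hlt
    rw [hdim', hdim₀] at h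
    have h' : (2 : ℕ) + 1 ≤ 2 := by exact_mod_cast h
    omega
  exact heq ▸ h𝔮₀min

/-- **Bézout over the c.i. curve `(Q, P)`**: with `(Q)` prime, `Q ≠ 0` a form of degree `a ≥ 1`,
`P ∉ (Q)` a form of degree `b ≥ 1`, every minimal prime `𝔮'` of `(Q, P)` has `deg 𝔮' ≤ ab` — the
`u`-resultant of `P` over the generic plane section of `V(Q)` is `c ∏_𝔮 F_𝔮^{e_𝔮}` over the minimal
primes (`e_𝔮 ≥ 1`), the unmixed ideal `J` of the cycle has `deg J = Σ e_𝔮 deg 𝔮` (Prop. 4.7 1)) and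
`deg J = deg_{u₁}(u-resultant) = deg (Q) · b = ab` (Prop. 4.8 1), 4.11).
[cite: NesterenkoPhilippon2001, Ch. 3 Prop. 4.7 1), Prop. 4.8 1), Prop. 4.11 (pp. 39–41)] -/
theorem ideg_le_of_mem_minimalPrimes (hQ0 : Q ≠ 0) (hQhom : Q.IsHomogeneous a) (ha : 1 ≤ a)
    (hQprime : (Ideal.span {Q}).IsPrime) (hPhom : P.IsHomogeneous b) (hb : 1 ≤ b)
    (hPQ : P ∉ Ideal.span {Q}) {𝔮' : Ideal (Rx 3)}
    (h𝔮'min : 𝔮' ∈ (Ideal.span {Q} ⊔ Ideal.span {P}).minimalPrimes) :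
    ideg 𝔮' 2 ≤ a * b := by
  classical
  have h44 := NesterenkoPhilippon2001_ch3_prop_4_4_holds
  have h𝔭hom : (Ideal.span {Q}).IsHomogeneous (homogeneousSubmodule (Fin (3 + 1)) ℚ) :=
    SpaceCI.isHomogeneous_span hQhom
  have h𝔭unm : IsUnmixedOfRank (Ideal.span {Q}) 3 :=
    isUnmixedOfRank_span_singleton hQ0 fun h => hQprime.ne_top (Ideal.span_singleton_eq_top.mpr h)
  have hP0 : P ≠ 0 := SpaceCI.ne_zero_of_notMem hPQ
  -- the finite set of minimal primes of `(Q, P)`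
  obtain ⟨𝓠, h𝓠, -⟩ := exists_finset_minimalPrimes_cut (𝔭 := Ideal.span {Q}) h𝔭hom hQprime.ne_top
    hPhom hb
  have hmem : 𝔮' ∈ 𝓠 := by rw [← Finset.mem_coe, h𝓠]; exact h𝔮'min
  -- a primitive integer model `P = p · P₀`
  obtain ⟨p, hp, P₀, hPP₀, hsupp, -⟩ := exists_eq_C_mul_map_primitive P hP0
  have hP₀ : P₀.IsHomogeneous b := by
    intro e he
    have he' : e ∈ P.support := by rw [← hsupp]; exact mem_support_iff.mpr he
    exact hPhom (mem_support_iff.mp he')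
  -- the `u`-resultant factors over the minimal primes with positive exponents
  obtain ⟨c, hc, e, he, hG⟩ := exists_uResultant_eq_C_mul_prod_pow (s := 2) (by norm_num)
    (by norm_num) hQprime h𝔭hom h𝔭unm hPhom hb hPQ hp hPP₀ hP₀ h𝓠
  -- the unmixed ideal of the cycle with these exponents: `deg J = Σ e_𝔮 deg 𝔮`
  obtain ⟨J, -, -, -, -, -, ⟨c₁, hc₁, hJF⟩, hdeg⟩ :=
    exists_cycle_ideal h44 (r := 2 + 1) (by norm_num) (by norm_num) hQprime h𝔭hom h𝔭unm hPhom hb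
      hPQ h𝓠 e he
  rw [Nat.add_sub_cancel] at hJF hdeg
  -- and `deg J = deg_{u₁}(u-resultant) = deg (Q) · b = ab`
  have hprod : ∏ 𝔮 ∈ 𝓠, chowForm 𝔮 2 ^ e 𝔮 = C c⁻¹ * uResultant (Ideal.span {Q}) 2 b P₀ := by
    rw [hG, ← mul_assoc, ← map_mul, inv_mul_cancel₀ hc, map_one, one_mul]
  rw [hprod, ← mul_assoc, ← map_mul] at hJF
  obtain ⟨hdegJ, -, -⟩ := invariants_of_chowForm_eq_C_mul (s := 2) (by norm_num)
    (mul_ne_zero hc₁ (inv_ne_zero hc)) hJF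
  have hbd : blockDeg (uResultant (Ideal.span {Q}) 2 b P₀) ⟨0, by norm_num⟩ =
      ideg (Ideal.span {Q}) 3 * b :=
    blockDeg_uResultant (s := 2) (by norm_num) (by norm_num) hQprime h𝔭hom h𝔭unm hPhom hb hPQ hp
      hPP₀ hP₀
  have hQdeg : ideg (Ideal.span {Q}) 3 = a := ideg_span_singleton (by norm_num) hQ0 hQhom ha
  have hsum : ∑ 𝔮 ∈ 𝓠, e 𝔮 * ideg 𝔮 2 = a * b := by rw [← hdeg, hdegJ, hbd, hQdeg]
  calc ideg 𝔮' 2 ≤ e 𝔮' * ideg 𝔮' 2 := Nat.le_mul_of_pos_left _ (he 𝔮' hmem)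
    _ ≤ ∑ 𝔮 ∈ 𝓠, e 𝔮 * ideg 𝔮 2 :=
      Finset.single_le_sum (f := fun 𝔮 => e 𝔮 * ideg 𝔮 2) (fun _ _ => Nat.zero_le _) hmem
    _ = a * b := hsum

end IdegLeMulOfRankTwoProof

/-- **Registered stub `ideg_le_mul_of_rankTwo`** (crux `stmt-Schanuel-6117`, line
`orbit-interpolation-determinant`, skeleton v24): BÉZOUT for a rank-2 prime over a complete
intersection of `ℚ[x₀, …, x₃]` — if `(Q)` is prime, `Q ≠ 0` a form of degree `a ≥ 1`, `P ∉ (Q)` a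
form of degree `b ≥ 1`, then every homogeneous prime `𝔮'` with `dim ℚ[x̲]/𝔮' = 2` containing `Q`
and `P` is a minimal prime of `(Q, P)` (`IdegLeMulOfRankTwoProof.mem_minimalPrimes`) and has
`deg 𝔮' ≤ ab` (`IdegLeMulOfRankTwoProof.ideg_le_of_mem_minimalPrimes`). The homogeneity hypothesis
is not used.
[cite: NesterenkoPhilippon2001, Ch. 3 Prop. 4.7 1), Prop. 4.8 1), Prop. 4.11 (pp. 39–41); Ch. 10 §3] -/
theorem ideg_le_mul_of_rankTwo : ∀ (Q P : Rx 3) (a b : ℕ), Q ≠ 0 → Q.IsHomogeneous a → P.IsHomogeneous b → 1 ≤ a → 1 ≤ b → (Ideal.span {Q}).IsPrime → P ∉ Ideal.span {Q} → ∀ 𝔮' : Ideal (Rx 3), 𝔮'.IsPrime → 𝔮'.IsHomogeneous (homogeneousSubmodule (Fin (3 + 1)) ℚ) → IsUnmixedOfRank 𝔮' 2 → Q ∈ 𝔮' → P ∈ 𝔮' → ideg 𝔮' 2 ≤ a * b := by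
  intro Q P a b hQ0 hQhom hPhom ha hb hQprime hPQ 𝔮' h𝔮'prime _ h𝔮'unm hQ𝔮' hP𝔮'
  exact IdegLeMulOfRankTwoProof.ideg_le_of_mem_minimalPrimes hQ0 hQhom ha hQprime hPhom hb hPQ
    (IdegLeMulOfRankTwoProof.mem_minimalPrimes hQ0 hQhom hPhom hQprime hPQ h𝔮'prime h𝔮'unm hQ𝔮'
      hP𝔮')

end Summit.Schanuel.Schanuel.Cruxes.ApproximationProperty.OrbitInterpolationDeterminant

end
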